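import Mathlib
import Summits.MatrixMultiplication.MatrixMultiplication.Theorems.SubgroupIdentityDesigns.Negative.Reversal

/-!
# A universal level-one identity design on the affine slice `{g ∈ GL₂(𝔽_p) : (g w)₁ = 1}` — all primes `p`
(cell B2b-5, crux `SubgroupIdentityDesigns` = stmt-MatrixMultiplication-14079, gen 8; companion of `FamilyA`;
report `run/shared/lean/b2b/levelgraded-cu/ORACLE-g8.md` §G8-2b).  VALUE = an all-`p` theorem with an explicit
witness, NOT summit progress: `m = 2` can never deliver the crux's `ε → 0`, and the crux item stays open.

For `w = (1,1)ᵀ`, `u_x = (1,x)ᵀ`, `e₂ = (0,1)ᵀ` and the fibre indicators `[g u = a]` (each a level-one function,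
`Reversal.fibreIndicator_mem_levelSet`), the level-one function
`f = p⁻¹ · ( [g e₂ = e₂] + Σ_{x ∈ 𝔽_p} ([g u_x = u_x] − [g u_x = w]) )`
satisfies `f(1) = 1` (`F_one`) and `f(g) = 0` for every `g ≠ 1` with `(g w)₁ = 1` (`F_zero`).  Geometry: the slice
`S = {g : (g w)₁ = 1}` (size `p²(p−1)`) is stratified by `β = g₀₁`; every fibre `[g u = a]` with `u ≠ w` meets `S`
inside one stratum, and inside the stratum `β = 0`, i.e. the plane `{(1,0; y,z)} ≅ 𝔽_p²` minus the line `z = 0`,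
the `p` available line classes (all slopes except that of `u = w`) isolate the identity `(y,z) = (0,1)` up to the
phantom point `(1,0)`, which is singular and hence invisible on `GL₂`; the denominator is `p`, as in every design
found by the exact census at `p = 11` (ORACLE-g8 §G8-2a, `PassV2200`).

CONSEQUENCE (`levelOne_design_of_slice`).  For ANY subgroups `H₁, H₂, H₃ ≤ GL₂(𝔽_p)` such that every `a ∈ H₁`
has first row `(1,0)`, `H₂ ⊆ {1, r}` with `r = (1,0;1,−1)`, and every `g ∈ H₃` fixes `w`, all products `abg` lie on
the slice (`slice_of_mul`), so the identity-design clause of the crux holds LITERALLY (a coefficient table `c`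
supported on rank `≤ 1` with `Σ_M c_M ψ(tr(M)) = 1` and `Σ_M c_M ψ(tr(M·abg)) = 0` for `abg ≠ 1`).  The maximal such
choice is the triple of `FamilyA` (`H₁ = {diag(1,t)}`, `H₂ = {1,r}`, `H₃ = Stab(w)`; subgroup TPP, no common
eigenvector, volume `2p(p−1)² > 2(p−1)³ =` the volume of the Borel family F of `BorelFamilyF`), so for EVERY odd
prime `p` the cell `(m,k) = (2,1)` has a non-Borel SubgroupTPP triple WITH a level-one identity design of volume
`2p(p−1)²`; at `p = 11` this is the census optimum `V*(2,1,11) = 2200` (ORACLE-g8 §G8-2, 18 certified designs, all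
conjugate to members of this family up to the choice of `H₂`).  The hypotheses are kept abstract here so that this
file does not depend on `FamilyA`; `FamilyA.mem_H₂`, `FamilyA.mem_H₃` and the definition of `FamilyA.H₁` discharge
them.
-/

set_option linter.dupNamespace false

open scoped BigOperators
open Summit.MatrixMultiplication.MatrixMultiplication.Theorems.LieRankDesigns.Negative
  (GLm Mat fourierFn RankSupp levelSet)
open Summit.MatrixMultiplication.MatrixMultiplication.Theorems.LieRankDesigns.LevelOfFixedVector
  (smul_mem_levelSet sum_mem_levelSet add_mem_levelSet)

namespace Summit.MatrixMultiplication.MatrixMultiplication.Theorems.SubgroupIdentityDesigns.Negative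

namespace FamilyADesign

variable {p : ℕ} [hp : Fact p.Prime]

/-- `u_x = (1, x)ᵀ`. -/
def ux (x : ZMod p) : Fin 2 → ZMod p := ![1, x]

/-- The fibre indicator `g ↦ [g u = a]`. -/
noncomputable def fib (u a : Fin 2 → ZMod p) (g : GLm p 2) : ℂ :=
  if (g : Mat p 2).mulVec u = a then 1 else 0

/-- `p · f`:  `F(g) = [g e₂ = e₂] + Σ_x ([g u_x = u_x] + (−1)·[g u_x = w])`. -/
noncomputable def F (g : GLm p 2) : ℂ :=
  fib ![0, 1] ![0, 1] g + ∑ x : ZMod p, (fib (ux x) (ux x) g + (-1) * fib (ux x) ![1, 1] g)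

/-- The universal design function `f = p⁻¹ F`. -/
noncomputable def f (g : GLm p 2) : ℂ := (p : ℂ)⁻¹ * F g

/-- Fibre indicators are level-one functions. -/
theorem fib_mem (u a : Fin 2 → ZMod p) : (fib u a : GLm p 2 → ℂ) ∈ levelSet p 2 1 :=
  Reversal.fibreIndicator_mem_levelSet u a

/-- `F` is a level-one function. -/
theorem F_mem : (F : GLm p 2 → ℂ) ∈ levelSet p 2 1 :=
  add_mem_levelSet (fib_mem _ _) (sum_mem_levelSet Finset.univ _ fun x _ =>
    add_mem_levelSet (fib_mem _ _) (smul_mem_levelSet (fib_mem (ux x) _) _))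

/-- `f` is a level-one function. -/
theorem f_mem : (f : GLm p 2 → ℂ) ∈ levelSet p 2 1 := smul_mem_levelSet F_mem _

/-- `2 × 2` matrix–vector product, entrywise. -/
theorem mulVec_two (A : Mat p 2) (v : Fin 2 → ZMod p) :
    A.mulVec v = ![A 0 0 * v 0 + A 0 1 * v 1, A 1 0 * v 0 + A 1 1 * v 1] := by
  ext i; fin_cases i <;> simp [Matrix.mulVec, dotProduct, Fin.sum_univ_two]

omit hp in
/-- Equality of `2`-vectors is equality of entries. -/
theorem vec2_eq {a b c d : ZMod p} : (![a, b] : Fin 2 → ZMod p) = ![c, d] ↔ a = c ∧ b = d := by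
  constructor
  · intro h; exact ⟨by simpa using congr_fun h 0, by simpa using congr_fun h 1⟩
  · rintro ⟨rfl, rfl⟩; rfl

/-- The fibre indicator `[g u_x = (a,b)ᵀ]` in terms of the entries of `g`. -/
theorem fib_ux (g : GLm p 2) (x a b : ZMod p) : fib (ux x) ![a, b] g =
    if (g : Mat p 2) 0 0 + (g : Mat p 2) 0 1 * x = a ∧ (g : Mat p 2) 1 0 + (g : Mat p 2) 1 1 * x = b
    then 1 else 0 := by
  simp [fib, ux]

/-- The fibre indicator `[g e₂ = e₂]` in terms of the entries of `g`. -/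
theorem fib_e₂ (g : GLm p 2) : fib ![0, 1] ![0, 1] g =
    if (g : Mat p 2) 0 1 = 0 ∧ (g : Mat p 2) 1 1 = 1 then 1 else 0 := by
  simp [fib]

/-- `[g u_x = u_x]` in terms of the entries of `g`. -/
theorem fib_uxux (g : GLm p 2) (x : ZMod p) : fib (ux x) (ux x) g =
    if (g : Mat p 2) 0 0 + (g : Mat p 2) 0 1 * x = 1 ∧ (g : Mat p 2) 1 0 + (g : Mat p 2) 1 1 * x = x
    then 1 else 0 := fib_ux g x 1 x

/-- The determinant of an element of `GL₂` is nonzero. -/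
theorem det_ne (g : GLm p 2) :
    (g : Mat p 2) 0 0 * (g : Mat p 2) 1 1 - (g : Mat p 2) 0 1 * (g : Mat p 2) 1 0 ≠ 0 := by
  have hdet : IsUnit (g : Mat p 2).det := (Matrix.isUnit_iff_isUnit_det _).1 (Units.isUnit g)
  rw [Matrix.det_fin_two] at hdet
  exact hdet.ne_zero

/-- `Σ_x (1 − [x = 1]) = p − 1` and friends: the sum of a point indicator over `𝔽_p`. -/
theorem sum_point (x₀ : ZMod p) (r : ℂ) :
    ∑ x : ZMod p, r * (if x = x₀ then (1 : ℂ) else 0) = r := by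
  rw [← Finset.mul_sum, Finset.sum_ite_eq' Finset.univ x₀ (fun _ => (1 : ℂ))]
  simp

/-- **`F(1) = p`.** -/
theorem F_one : F (1 : GLm p 2) = p := by
  have h1 : ∀ x : ZMod p, fib (ux x) (ux x) (1 : GLm p 2) + (-1) * fib (ux x) ![1, 1] 1
      = 1 + (-1) * (if x = 1 then 1 else 0) := fun x => by
    rw [fib_uxux, fib_ux]; simp
  have h2 : fib ![0, 1] ![0, 1] (1 : GLm p 2) = 1 := by rw [fib_e₂]; simp
  rw [F, h2, Finset.sum_congr rfl (fun x _ => h1 x), Finset.sum_add_distrib, sum_point]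
  simp only [Finset.sum_const, Finset.card_univ, ZMod.card, nsmul_eq_mul, mul_one]
  ring

/-- **`F(g) = 0` on the slice `(g w)₁ = 1` away from the identity.** -/
theorem F_zero (g : GLm p 2) (hS : (g : Mat p 2) 0 0 + (g : Mat p 2) 0 1 = 1) (hg : g ≠ 1) :
    F g = 0 := by
  have hdet := det_ne g
  rw [F, fib_e₂]
  simp only [fib_uxux, fib_ux]
  set a := (g : Mat p 2) 0 0 with ha'
  set b := (g : Mat p 2) 0 1 with hb'
  set c := (g : Mat p 2) 1 0 with hc'
  set d := (g : Mat p 2) 1 1 with hd'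
  by_cases hb : b = 0
  · -- the plane `b = 0`, `a = 1`; `d ≠ 0` by invertibility
    have ha : a = 1 := by rw [hb, add_zero] at hS; exact hS
    have hd0 : d ≠ 0 := by
      intro h; apply hdet; rw [ha, hb, h]; ring
    by_cases hd1 : d = 1
    · -- horizontal line `d = 1`: then `c ≠ 0` since `g ≠ 1`
      have hc : c ≠ 0 := by
        intro hc
        apply hg
        apply Units.ext
        ext i j
        fin_cases i <;> fin_cases j
        · simpa using ha
        · simpa using hb
        · simpa using hc
        · simpa using hd1
      have key : ∀ x : ZMod p, (c + x = 1) ↔ (x = 1 - c) := fun x => by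
        constructor <;> intro h <;> linear_combination h
      have h1 : ∀ x : ZMod p,
          ((if a + b * x = 1 ∧ c + d * x = x then (1 : ℂ) else 0)
            + (-1) * (if a + b * x = 1 ∧ c + d * x = 1 then 1 else 0))
          = 0 + (-1) * (if x = 1 - c then 1 else 0) := fun x => by
        rw [ha, hb, hd1]; simp [hc, key]
      rw [Finset.sum_congr rfl (fun x _ => h1 x), Finset.sum_add_distrib, sum_point]
      simp [hb, hd1]
    · -- generic line `d ∉ {0, 1}`: exactly one hit of each kind
      have keyA : ∀ x : ZMod p, (c + d * x = x) ↔ (x = (1 - d)⁻¹ * c) := fun x => by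
        rw [eq_inv_mul_iff_mul_eq₀ (sub_ne_zero.mpr (Ne.symm hd1))]
        constructor <;> intro h <;> linear_combination (-1 : ZMod p) * h
      have keyB : ∀ x : ZMod p, (c + d * x = 1) ↔ (x = d⁻¹ * (1 - c)) := fun x => by
        rw [eq_inv_mul_iff_mul_eq₀ hd0]
        constructor <;> intro h <;> linear_combination h
      have h1 : ∀ x : ZMod p,
          ((if a + b * x = 1 ∧ c + d * x = x then (1 : ℂ) else 0)
            + (-1) * (if a + b * x = 1 ∧ c + d * x = 1 then 1 else 0))
          = 1 * (if x = (1 - d)⁻¹ * c then 1 else 0) + (-1) * (if x = d⁻¹ * (1 - c) then 1 else 0) :=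
        fun x => by rw [ha, hb]; simp [keyA, keyB]
      rw [Finset.sum_congr rfl (fun x _ => h1 x), Finset.sum_add_distrib, sum_point, sum_point]
      simp [hd1]
  · -- off the plane: `b ≠ 0` forces `x = 1` in both indicators, where they agree
    have h1 : ∀ x : ZMod p,
        ((if a + b * x = 1 ∧ c + d * x = x then (1 : ℂ) else 0)
          + (-1) * (if a + b * x = 1 ∧ c + d * x = 1 then 1 else 0)) = 0 := by
      intro x
      by_cases hx : x = 1
      · rw [hx, mul_one]; split_ifs <;> ring
      · have hax : ¬ (a + b * x = 1) := by
          intro h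
          apply hx
          have hbx : b * (x - 1) = 0 := by linear_combination h - hS
          rcases mul_eq_zero.1 hbx with h' | h'
          · exact absurd h' hb
          · exact sub_eq_zero.1 h'
        simp [hax]
    rw [Finset.sum_eq_zero (fun x _ => h1 x)]
    simp [hb]

/-- **Products of the family-A shape lie on the slice.**  If `a` has first row `(1, 0)`, `b ∈ {1, r}` with
`r = (1,0;1,−1)`, and `g` fixes `w = (1,1)ᵀ`, then `((abg) w)₁ = 1`. -/
theorem slice_of_mul (a b g : GLm p 2) (ha : (a : Mat p 2) 0 0 = 1 ∧ (a : Mat p 2) 0 1 = 0)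
    (hb : b = 1 ∨ (b : Mat p 2) = !![1, 0; 1, -1]) (hg : (g : Mat p 2).mulVec ![1, 1] = ![1, 1]) :
    ((a * b * g : GLm p 2) : Mat p 2) 0 0 + ((a * b * g : GLm p 2) : Mat p 2) 0 1 = 1 := by
  have key : (((a * b * g : GLm p 2) : Mat p 2).mulVec ![1, 1]) 0 = 1 := by
    rw [Units.val_mul, Units.val_mul, ← Matrix.mulVec_mulVec, ← Matrix.mulVec_mulVec, hg]
    rcases hb with rfl | hb
    · rw [Units.val_one, Matrix.one_mulVec, mulVec_two]; simp [ha.1, ha.2]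
    · rw [hb, mulVec_two (a : Mat p 2)]; simp [ha.1, ha.2]
  rw [mulVec_two] at key
  simpa using key

/-- **THE UNIVERSAL LEVEL-ONE IDENTITY DESIGN (all primes `p`).**  Let `H₁, H₂, H₃ ≤ GL₂(𝔽_p)` be ANY subgroups
with: every `a ∈ H₁` has first row `(1, 0)`; `H₂ ⊆ {1, r}`, `r = (1,0;1,−1)`; every `g ∈ H₃` fixes `w = (1,1)ᵀ`
(the subgroups `H₁ = {diag(1,t)}`, `H₂ = {1,r}`, `H₃ = Stab(w)` of `FamilyA` are the maximal such choice, of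
volume `2p(p−1)²`).  Then the identity-design clause of the crux `SubgroupIdentityDesigns` holds at level
`k = 1` LITERALLY: there is a coefficient table `c` on `Mat₂(𝔽_p)` vanishing on matrices of rank `> 1` with
`Σ_M c_M ψ(tr(M·1)) = 1` and `Σ_M c_M ψ(tr(M·abg)) = 0` whenever `a ∈ H₁, b ∈ H₂, g ∈ H₃, abg ≠ 1`.  The witness is
the explicit function `f = p⁻¹ F` of this file.  VALUE = theorem with explicit witness, NOT summit progress. -/
theorem levelOne_design_of_slice {H₁ H₂ H₃ : Subgroup (Matrix.GeneralLinearGroup (Fin 2) (ZMod p))}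
    (h₁ : ∀ a ∈ H₁, (a : Matrix (Fin 2) (Fin 2) (ZMod p)) 0 0 = 1 ∧
      (a : Matrix (Fin 2) (Fin 2) (ZMod p)) 0 1 = 0)
    (h₂ : ∀ b ∈ H₂, b = 1 ∨ (b : Matrix (Fin 2) (Fin 2) (ZMod p)) = !![1, 0; 1, -1])
    (h₃ : ∀ g ∈ H₃, (g : Matrix (Fin 2) (Fin 2) (ZMod p)).mulVec ![1, 1] = ![1, 1]) :
    ∃ c : Matrix (Fin 2) (Fin 2) (ZMod p) → ℂ, (∀ M, 1 < M.rank → c M = 0) ∧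
      (∑ M : Matrix (Fin 2) (Fin 2) (ZMod p), c M * ZMod.stdAddChar (Matrix.trace
        (M * ((1 : Matrix.GeneralLinearGroup (Fin 2) (ZMod p)) : Matrix (Fin 2) (Fin 2) (ZMod p))))) = 1 ∧
      ∀ a ∈ H₁, ∀ b ∈ H₂, ∀ g ∈ H₃, a * b * g ≠ 1 →
        (∑ M : Matrix (Fin 2) (Fin 2) (ZMod p), c M * ZMod.stdAddChar (Matrix.trace
          (M * ((a * b * g : Matrix.GeneralLinearGroup (Fin 2) (ZMod p)) :
            Matrix (Fin 2) (Fin 2) (ZMod p))))) = 0 := by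
  obtain ⟨c, hc, hcf⟩ := (f_mem : (f : GLm p 2 → ℂ) ∈ levelSet p 2 1)
  have hp0 : (p : ℂ) ≠ 0 := Nat.cast_ne_zero.mpr hp.out.ne_zero
  refine ⟨c, hc, ?_, ?_⟩
  · show fourierFn c 1 = 1
    rw [← hcf 1, f, F_one, inv_mul_cancel₀ hp0]
  · intro a ha b hb g hg hne
    show fourierFn c (a * b * g) = 0
    rw [← hcf _, f, F_zero _ (slice_of_mul a b g (h₁ a ha) (h₂ b hb) (h₃ g hg)) hne, mul_zero]

end FamilyADesign

end Summit.MatrixMultiplication.MatrixMultiplication.Theorems.SubgroupIdentityDesigns.Negative
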